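/-
COR-CM (cells pub-hodgecm / pub-hodgecm2, stage 2 of the Hodge ladder) — TRANSPOSITION, item (vi) S2 pinning, binder `hComp`,
TEAM hComp row U1d (HOME/pinning/HCOMP-TABLE.md v1.1): the DICTIONARY `HermSpace3 ↦ hypotheses of the canonical-model record`
at `(L, H, τ) := (F, V.Hm, ι₁)`.  Seat prover-pub-hodgecm2-hcomp-shimura-0 (TEAM hComp seat `hcomp-shimura`, coordinator ruling
2026-08-21T18:44:30Z (1); team path `Transposition/HComp/` under the pub-hodgecm2 lead's staging l.4797 / l.5050).  THREE DEFINITIONS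
by `Classical.choice`/`Exists.choose` (`Model.frameOf`, `Model.recordAt` — NAMED TERMS the team reads identically everywhere, hcomp-lead
design point S6 / U1d (iii′), HOME/INBOX 19:29:06Z) and theorems; no instance, no named fact, no `variable`, nothing asserted, no proof
holes.  T5: n/a (at most ONE `Prop` hypothesis binder, `h : exists_recordSystem`, per declaration).  FRAMING: HC_CM is NOT proved;
nothing here discharges `hComp`.
-/
import Summits.HodgeConjecture.CorCM.CM.Basic
import Literature.AlgebraicGeometry.ShimuraVarieties.UnitaryShimuraCanonicalModel
import HarnessLib

/-!
# The tree's hermitian 3-space `V : HermSpace3 F ι₁` meets the hypotheses of Deligne's canonical-model record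

`Literature.AlgebraicGeometry.ShimuraVarieties.UnitaryShimuraCanonicalModel` (htheta-x1 g6, p300116 ✔ / p300252 ✔) records
Deligne's canonical model of the compact unitary Shimura surface as `UnitaryCanonicalModel.RecordSystem L H τ T hT K₀` and the
named fact `UnitaryCanonicalModel.exists_recordSystem` ([Deligne1979] 2.2.5 + Cor. 2.7.21), whose hypotheses are, for a CM
field `L`, `H ∈ M₃(L)`, `τ : L →+* ℂ`: (a) a frame `T ∈ GL₃(ℂ)` with `formCongr (starRingEnd ℂ) T (H.map τ) = BallModel.J`
(`Tᴴ H^τ T = diag(1,1,-1)`); (b) `H^{τ'}` positive definite at every complex embedding `τ'` off the place of `τ`; (c) the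
hermitian form of `H` anisotropic over `L`; (d) an open compact `K₀ ≤ U(H)(𝔸_{L⁺,f})` all of whose conjugate arithmetic levels
`Γ_H(gK₀g⁻¹)` are torsion-free.  This file reads (a)–(c) off the tree's `HermSpace3 F ι₁` (`CorCM/CM/Basic.lean` :182–191:
`Hm`, `isHermitian`, `signature_ι₁ : ∃ T, Tᴴ * Hm.map ι₁ * T = signatureMatrix 2`, `posDef_of_ne`) for a CM field `F` of degree
`≥ 4` over `ℚ` (so that a second complex place exists — the face guards of the consumers give `6 ≤ [F:ℚ]`), leaving (d) as the
hypothesis `htf` (supplied at `K₀ := K_f(3)` by the team row U2c, `HComp/Levels.lean`, from the tree's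
`UnitaryGroup.torsionFree_arithmeticLevel_map_conj`):

* `HermSpace3.exists_frame_formCongr` — (a) from `V.signature_ι₁` (`signatureMatrix 2 = BallModel.J`, tree
  `UnitaryGroup.formCongr_eq_J_of_conjTranspose_mul_mul`); NAMED: `Model.frameOf V` (a CHOSEN Sylvester frame, `Exists.choose` on
  `V.signature_ι₁`) with both readings `Model.conjTranspose_frameOf_mul_mul` (`Tᴴ H^{ι₁} T = signatureMatrix 2`, the
  `UnitaryBallUniformisationDatum.signature_τ₁` direction) and `Model.formCongr_frameOf` (the record's direction);
* `HermSpace3.anisotropic_of_four_le` — (c) from (b) = `V.posDef_of_ne` at a complex place `≠` that of `ι₁`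
  (`UnitaryGroup.exists_infinitePlace_ne`, `UnitaryGroup.anisotropic_of_posDef_map`: a form positive definite at one complex
  place has no isotropic vector);
* **`Model.exists_recordSystem_hermSpace3`** — the END theorem of the row: from the named fact `h : exists_recordSystem`, for
  `V : HermSpace3 F ι₁`, `4 ≤ [F:ℚ]` and an open compact `K₀ ≤ U(V)(𝔸_{F⁺,f})` with torsion-free conjugate arithmetic levels, there
  are a frame `(T, hT)` and a canonical-model system `RecordSystem F V.Hm ι₁ T hT K₀` (∃-packaged); NAMED:
  **`Model.recordAt h V h4 K₀ htf : RecordSystem F V.Hm ι₁ (Model.frameOf V) (Model.formCongr_frameOf V) K₀`** — THE chosen system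
  (`Classical.choice`), the one term the team's honest `P5` (row U2a, `S := Model.recordAt h V h4 (K3 V) (…)` at hcomp-level's small
  level `K3 V = K_f(3)` with its torsion-freeness lemma, row U2c) and `hUnif_holds` (row U5, `S.pieces`) both read, so that no two
  `Classical.choice`s ever meet (hcomp-lead S6);
* `Model.finite_shimuraIndex` — the index of pieces `Ξ_K = U(V)(F⁺) \ U(V)(𝔸_{F⁺,f}) / K` is finite for every OPEN `K`
  (tree `Deligne1979.finite_index_of_posDef_of_ne`); consumers obtain `Fintype Ξ_K` by `Fintype.ofFinite`.

References: P. Deligne, *Variétés de Shimura: interprétation modulaire…*, PSPM XXXIII.2 (1979), 2.1.2, 2.2.5, Cor. 2.7.21 (as cited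
by the record file); N. Bergeron, J. Millson, C. Moeglin, Acta Math. 216 (2016) Part 2 §1.1 (hermitian 3-spaces of signature
`(2,1)` over a CM field, definite at the other places — the shape of `HermSpace3`).
-/

noncomputable section

namespace Summit.HodgeConjecture.CorCM

open MulAction NumberField Matrix
open scoped Matrix ComplexOrder
open Literature.AlgebraicGeometry.ShimuraVarieties
open Literature.AlgebraicGeometry.ShimuraVarieties.UnitaryCanonicalModel
open Literature.NumberTheory.Automorphic Literature.NumberTheory.Automorphic.UnitaryGroup
open Literature.NumberTheory.Automorphic.ShimuraDissection
open Literature.NumberTheory.Automorphic.Liu2021.AppendixC (C5.OpenCompactSubgroup)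
open Literature.Geometry.ComplexHyperbolic

namespace HermSpace3

variable {F : CMField} {ι₁ : F →+* ℂ}

/-- **(a) A frame in the record's currency.**  The signature clause of `HermSpace3` (`∃ T, Tᴴ * Hm.map ι₁ * T =
signatureMatrix 2`) gives a `T ∈ GL₃(ℂ)` with `formCongr (starRingEnd ℂ) T (V.Hm.map ι₁) = BallModel.J`, the frame hypothesis
of `UnitaryCanonicalModel.RecordSystem` / `exists_recordSystem` (tree `UnitaryGroup.formCongr_eq_J_of_conjTranspose_mul_mul`,
`signatureMatrix 2 = BallModel.J = diag(1,1,-1)`).  Bookkeeping, ours. -/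
theorem exists_frame_formCongr (V : HermSpace3 F ι₁) :
    ∃ T : GL (Fin 3) ℂ, formCongr (starRingEnd ℂ) T (V.Hm.map ι₁) = BallModel.J := by
  obtain ⟨T, hT⟩ := V.signature_ι₁
  exact ⟨T, formCongr_eq_J_of_conjTranspose_mul_mul V.Hm ι₁ hT⟩

/-- **(c) Anisotropy.**  For a CM field of degree `≥ 4` there is a complex place other than that of `ι₁`
(`UnitaryGroup.exists_infinitePlace_ne`); there `V.Hm` is positive definite (`V.posDef_of_ne`), so its hermitian form has no
isotropic vector over `F` (`UnitaryGroup.anisotropic_of_posDef_map`) — the anisotropy hypothesis of `exists_recordSystem`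
(Compact Case).  Bookkeeping, ours. -/
theorem anisotropic_of_four_le (V : HermSpace3 F ι₁) (h4 : 4 ≤ Module.finrank ℚ F) :
    ∀ v : Fin 3 → F, hermForm (cmConjRingHom F) V.Hm v v = 0 → v = 0 := by
  obtain ⟨τ, hτ⟩ := exists_infinitePlace_ne (L := F) h4 ι₁
  exact anisotropic_of_posDef_map F V.Hm τ (V.posDef_of_ne τ hτ)

end HermSpace3

namespace Model

variable {F : CMField} {ι₁ : F →+* ℂ}

/-- **A chosen Sylvester frame of `V` at `ι₁`**: some `T ∈ GL₃(ℂ)` with `Tᴴ · V.Hm^{ι₁} · T = diag(1,1,-1)` (`Exists.choose` on the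
field `V.signature_ι₁` of `HermSpace3`).  A NAMED TERM so that every team file reads the same frame (hcomp-lead S6 / U1d (iii′)).
Nothing is asserted. -/
noncomputable def frameOf (V : HermSpace3 F ι₁) : GL (Fin 3) ℂ :=
  V.signature_ι₁.choose

/-- The chosen frame is a Sylvester frame in the `UnitaryBallUniformisationDatum.signature_τ₁` direction:
`(frameOf V)ᴴ * V.Hm.map ι₁ * frameOf V = signatureMatrix 2`.  Bookkeeping (`Exists.choose_spec`). -/
theorem conjTranspose_frameOf_mul_mul (V : HermSpace3 F ι₁) :
    (frameOf V : Matrix (Fin 3) (Fin 3) ℂ)ᴴ * V.Hm.map ι₁ * (frameOf V : Matrix (Fin 3) (Fin 3) ℂ) = signatureMatrix 2 :=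
  V.signature_ι₁.choose_spec

/-- The chosen frame in the record's currency: `formCongr (starRingEnd ℂ) (frameOf V) (V.Hm.map ι₁) = BallModel.J` — the frame
hypothesis `hT` of `UnitaryCanonicalModel.RecordSystem` / `exists_recordSystem` (tree
`UnitaryGroup.formCongr_eq_J_of_conjTranspose_mul_mul`).  Bookkeeping, ours. -/
theorem formCongr_frameOf (V : HermSpace3 F ι₁) :
    formCongr (starRingEnd ℂ) (frameOf V) (V.Hm.map ι₁) = BallModel.J :=
  formCongr_eq_J_of_conjTranspose_mul_mul V.Hm ι₁ (conjTranspose_frameOf_mul_mul V)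

/-- **THE chosen canonical-model system of the tree's hermitian 3-space** (row U1d (iii′), hcomp-lead S6): for the named fact
`h : UnitaryCanonicalModel.exists_recordSystem` ([Deligne1979] 2.2.5 + Cor. 2.7.21 as recorded in
`Literature/AlgebraicGeometry/ShimuraVarieties/UnitaryShimuraCanonicalModel.lean`), `V : HermSpace3 F ι₁` with `4 ≤ [F:ℚ]`, and an
open compact `K₀ ≤ U(V)(𝔸_{F⁺,f})` with torsion-free conjugate arithmetic levels (`htf`), a CHOSEN (`Classical.choice`)
`RecordSystem F V.Hm ι₁ (frameOf V) (formCongr_frameOf V) K₀` — the projective system `K ↦ M_K`, `K ≤ K₀`, of Deligne's models over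
`F` (along `ι₁`) of `Sh(Res_{F⁺/ℚ} U(V), 𝔹²)_K` on the TAUTOLOGICAL ball of `V.Hm^{ι₁}` (datum `h_{V,ῑ₁}`, reflex field `ι₁(F)`),
with its complex points, holomorphy and reciprocity clauses (and, from the record's v5 on, its complex uniformisation `pieces`).
Hypotheses (a)–(c) of the fact are read off `V` (`frameOf`, `V.posDef_of_ne`, `HermSpace3.anisotropic_of_four_le`); (d) is `htf`
(at `K₀ := K3 V = K_f(3)` it is hcomp-level's lemma, row U2c).  ONE NAMED TERM: the team's honest `PropC5Data` (row U2a) and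
`hUnif_holds` (row U5) both read `Model.recordAt h V h4 K₀ htf`, so no two choices meet.  CONDITIONAL on `h`; nothing is asserted
about Liu's objects; HC_CM is NOT proved and `hComp` is not discharged here. -/
noncomputable def recordAt (h : exists_recordSystem) (V : HermSpace3 F ι₁) (h4 : 4 ≤ Module.finrank ℚ F)
    (K₀ : C5.OpenCompactSubgroup ↥V.adelicFin)
    (htf : ∀ g : V.adelicFin,
      ∀ γ ∈ arithmeticLevel (↥(maximalRealSubfield F)) F (IsCMField.complexConj F) 3 V.Hm
        (K₀.1.map (MulAut.conj g).toMonoidHom), IsOfFinOrder γ → γ = 1) :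
    RecordSystem F V.Hm ι₁ (frameOf V) (formCongr_frameOf V) K₀ :=
  Classical.choice (h F V.Hm ι₁ (frameOf V) (formCongr_frameOf V) V.posDef_of_ne (V.anisotropic_of_four_le h4) K₀ htf)

/-- **Deligne's canonical-model system for the tree's hermitian 3-space** (row U1d END theorem, ∃-form): from the named fact
`UnitaryCanonicalModel.exists_recordSystem` ([Deligne1979] 2.2.5 + Cor. 2.7.21, as recorded in
`Literature/AlgebraicGeometry/ShimuraVarieties/UnitaryShimuraCanonicalModel.lean`), for `V : HermSpace3 F ι₁` over a CM field
with `4 ≤ [F:ℚ]` and an open compact level `K₀ ≤ U(V)(𝔸_{F⁺,f})` all of whose conjugate arithmetic levels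
`Γ_{V.Hm}(gK₀g⁻¹) = U(V)(F⁺) ∩ gK₀g⁻¹` are torsion-free, there exist a frame `T` (`formCongr (starRingEnd ℂ) T (V.Hm.map ι₁) =
BallModel.J`) and a `RecordSystem F V.Hm ι₁ T hT K₀` — the projective system `K ↦ M_K`, `K ≤ K₀`, of models over `F` (along
`ι₁`) of `Sh(Res_{F⁺/ℚ} U(V), 𝔹²)_K` on the TAUTOLOGICAL ball of `V.Hm^{ι₁}` (datum `h_{V,ῑ₁}`, reflex field `ι₁(F)`), with its
complex points, holomorphy and reciprocity clauses.  Hypotheses (a)–(c) of the fact are read off `V`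
(`HermSpace3.exists_frame_formCongr`, `V.posDef_of_ne`, `HermSpace3.anisotropic_of_four_le`); (d) is `htf`.  CONDITIONAL on the
named fact `h` (one binder); nothing else is assumed.  HC_CM is NOT proved; this is the Shimura-side CARRIER of the team's
honest `PropC5Data` (row U2a), not a discharge of `hComp`. -/
theorem exists_recordSystem_hermSpace3 (h : exists_recordSystem) (V : HermSpace3 F ι₁) (h4 : 4 ≤ Module.finrank ℚ F)
    (K₀ : C5.OpenCompactSubgroup ↥V.adelicFin)
    (htf : ∀ g : V.adelicFin,
      ∀ γ ∈ arithmeticLevel (↥(maximalRealSubfield F)) F (IsCMField.complexConj F) 3 V.Hm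
        (K₀.1.map (MulAut.conj g).toMonoidHom), IsOfFinOrder γ → γ = 1) :
    ∃ (T : GL (Fin 3) ℂ) (hT : formCongr (starRingEnd ℂ) T (V.Hm.map ι₁) = BallModel.J),
      Nonempty (RecordSystem F V.Hm ι₁ T hT K₀) :=
  ⟨frameOf V, formCongr_frameOf V, ⟨recordAt h V h4 K₀ htf⟩⟩

/-- The same at ONE open compact level `K` with torsion-free conjugate arithmetic levels: a frame and a one-level
`UnitaryCanonicalModel.Record F V.Hm ι₁ T hT K` (the system below `K₀ := K` read at `K`; cf. the record file's `exists_record`).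
CONDITIONAL on the named fact `h`.  HC_CM is NOT proved. -/
theorem exists_record_hermSpace3 (h : exists_recordSystem) (V : HermSpace3 F ι₁) (h4 : 4 ≤ Module.finrank ℚ F)
    (K : Subgroup V.adelicFin) (hKo : IsOpen (K : Set V.adelicFin)) (hKc : IsCompact (K : Set V.adelicFin))
    (htf : ∀ g : V.adelicFin,
      ∀ γ ∈ arithmeticLevel (↥(maximalRealSubfield F)) F (IsCMField.complexConj F) 3 V.Hm
        (K.map (MulAut.conj g).toMonoidHom), IsOfFinOrder γ → γ = 1) :
    ∃ (T : GL (Fin 3) ℂ) (hT : formCongr (starRingEnd ℂ) T (V.Hm.map ι₁) = BallModel.J),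
      Nonempty (Record F V.Hm ι₁ T hT K) := by
  obtain ⟨T, hT⟩ := V.exists_frame_formCongr
  exact ⟨T, hT, exists_record h F V.Hm ι₁ T hT V.posDef_of_ne (V.anisotropic_of_four_le h4) K hKo hKc htf⟩

/-- **The index of pieces is finite**: for `V : HermSpace3 F ι₁`, `4 ≤ [F:ℚ]` and an OPEN level `K ≤ U(V)(𝔸_{F⁺,f})`, the set
of double coset classes `Ξ_K = U(V)(F⁺) \ U(V)(𝔸_{F⁺,f}) / K` indexing the pieces of `Sh_K(ℂ)` ([Deligne1979] 2.1.2 «the finite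
set `G(ℚ)₊ \ G(𝔸^f)/K`»; tree `Deligne1979.finite_index_of_posDef_of_ne`, Godement's criterion through `V.posDef_of_ne`) is
finite.  Consumers needing a `Fintype` use `Fintype.ofFinite`.  Bookkeeping, ours. -/
theorem finite_shimuraIndex (V : HermSpace3 F ι₁) (h4 : 4 ≤ Module.finrank ℚ F) (K : Subgroup V.adelicFin)
    (hK : IsOpen (K : Set V.adelicFin)) :
    Finite (orbitRel.Quotient (rational (↥(maximalRealSubfield F)) F (IsCMField.complexConj F) 3 V.Hm)
      (CosetSpace (rationalToFinAdelic (↥(maximalRealSubfield F)) F (IsCMField.complexConj F) 3 V.Hm) K)) :=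
  Deligne1979.finite_index_of_posDef_of_ne F V.Hm ι₁ K h4 V.posDef_of_ne hK

end Model

end Summit.HodgeConjecture.CorCM

end
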